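import Mathlib
import Literature.Probability.LatticeModels.BinomialEntropy
import Summits.PneNP.PneNP.Theorems.OverlapGapAlgebraNoStableSectionDefs

/-!
# Crux `SolvableImpliesStableSection` (stmt-PneNP-2463) — negative lemmas, part 1:
# the first-moment count of near-valid origins

For ANY map `g : Inst → (Fin n → Bool)` and `0 ≤ ν ≤ 1/2`, the path tuples
`Ψ : Fin (k+1) → Inst` (with `Inst = Fin m → Fin k → Fin n × Bool`) on whose origin `Ψ 0` the
assignment `g (Ψ 0)` violates at most `ν m` clauses number at most
`2^n · (⌊ν m⌋₊ + 1) · e^{m h₂(ν)} · e^{-2^{-k}(1-ν) m} · #paths` (`card_originValid_le`): union over the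
`2^n` assignments of the single-instance count `#{Φ : violCount y Φ ≤ J} ≤ (Σ_{j≤J} C(m,j))(1-2^{-k})^{m-J} #Inst`,
binomials by the entropy bound, `1 - p ≤ e^{-p}`.  Part 2 (`…/Negative/FalseWithoutSolvable.lean`) turns
this into the failure of the crux's conclusion in the unsatisfiable phase.

The two private counting lemmas `ov_card_violCount_le` and `ov_choose_le_exp_binEntropy` (with their
three auxiliaries) are VERBATIM copies of `DartGame.ind_card_violCount_le`
(`Theorems/OverlapGapAlgebraNoStableSectionIndep.lean`) and `DartGame.cnt_choose_le_exp_binEntropy`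
(`Theorems/OverlapGapAlgebraNoStableSectionCount.lean`), renamed and inlined so that this file
depends only on `…NoStableSectionDefs` (the farm had not built those two modules when this was filed;
a later clean-up may replace the copies by imports).  Standing disprover of the crux, cycle 1.
-/

set_option linter.dupNamespace false

namespace Summit.PneNP.PneNP.Cruxes.SolvableImpliesStableSection.Negative

open Finset
open Summit.PneNP.PneNP.Cruxes.NoStableSection.DartGame (violCount Inst)

/-! ## Copied counting lemmas (see the module docstring) -/

section Copies

open Real

variable {k m n : ℕ}

/-- The clauses falsified by `y` are exactly the `n^k` clauses `r ↦ (v r, ! y (v r))`. -/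
private theorem ov_card_falsified (y : Fin n → Bool) :
    (univ.filter fun C : Fin k → Fin n × Bool => ∀ r, y (C r).1 ≠ (C r).2).card = n ^ k := by
  have key : (univ.filter fun C : Fin k → Fin n × Bool => ∀ r, y (C r).1 ≠ (C r).2) =
      univ.map ⟨fun v : Fin k → Fin n => fun r => (v r, !y (v r)), fun v w h => by
        funext r
        simpa using congrArg (fun C : Fin k → Fin n × Bool => (C r).1) h⟩ := by
    ext C
    simp only [mem_filter, mem_univ, true_and, mem_map, Function.Embedding.coeFn_mk]
    constructor
    · intro h
      refine ⟨fun r => (C r).1, funext fun r => Prod.ext rfl ?_⟩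
      dsimp only
      have hr := h r
      revert hr
      cases y (C r).1 <;> cases (C r).2 <;> decide
    · rintro ⟨v, rfl⟩ r
      dsimp only
      cases y (v r) <;> decide
  rw [key, card_map, card_univ, Fintype.card_fun, Fintype.card_fin, Fintype.card_fin]

/-- Hence, as a real number, the clauses NOT falsified by `y` number `(1 - 2^{-k}) · (2n)^k`. -/
private theorem ov_card_notFalsified (y : Fin n → Bool) :
    ((univ.filter fun C : Fin k → Fin n × Bool => ¬∀ r, y (C r).1 ≠ (C r).2).card : ℝ) =
      (1 - (1 / 2 : ℝ) ^ k) * Fintype.card (Fin k → Fin n × Bool) := by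
  have h := Finset.card_filter_add_card_filter_not (s := (univ : Finset (Fin k → Fin n × Bool)))
    (fun C : Fin k → Fin n × Bool => ∀ r, y (C r).1 ≠ (C r).2)
  rw [ov_card_falsified, card_univ] at h
  have hcard : Fintype.card (Fin k → Fin n × Bool) = (n * 2) ^ k := by
    rw [Fintype.card_fun, Fintype.card_prod, Fintype.card_fin, Fintype.card_fin, Fintype.card_bool]
  rw [hcard] at h ⊢
  have h' : ((univ.filter fun C : Fin k → Fin n × Bool => ¬∀ r, y (C r).1 ≠ (C r).2).card : ℝ) =
      ((n : ℝ) * 2) ^ k - (n : ℝ) ^ k := by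
    have := congrArg (Nat.cast : ℕ → ℝ) h
    push_cast at this
    linarith
  have hpow : (1 / 2 : ℝ) ^ k * ((n : ℝ) * 2) ^ k = (n : ℝ) ^ k := by
    rw [← mul_pow]
    congr 1
    ring
  rw [h']
  push_cast
  linear_combination hpow

/-- The instances whose clauses outside `S` are not falsified by `y` form a product set of
cardinality `(1 - 2^{-k})^{m - #S} · #Inst`. -/
private theorem ov_card_goodOutside (y : Fin n → Bool) (S : Finset (Fin m)) :
    ((Fintype.piFinset fun i : Fin m => if i ∈ S then (univ : Finset (Fin k → Fin n × Bool))
        else univ.filter fun C : Fin k → Fin n × Bool => ¬∀ r, y (C r).1 ≠ (C r).2).card : ℝ) =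
      (1 - (1 / 2 : ℝ) ^ k) ^ (m - S.card) * Fintype.card (Inst m k n) := by
  have hS : (univ.filter fun i : Fin m => i ∈ S) = S := by ext i; simp
  have hSc : (univ.filter fun i : Fin m => ¬i ∈ S) = Sᶜ := by ext i; simp
  rw [Fintype.card_piFinset, prod_congr rfl fun i _ => apply_ite Finset.card (i ∈ S) _ _, prod_ite,
    prod_const, prod_const, hS, hSc, Finset.card_compl, Fintype.card_fin]
  push_cast
  rw [card_univ, ov_card_notFalsified y]
  have hInst : (Fintype.card (Inst m k n) : ℝ) = (Fintype.card (Fin k → Fin n × Bool) : ℝ) ^ m := by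
    rw [Fintype.card_fun, Fintype.card_fin]
    push_cast
    rfl
  have hSm : S.card ≤ m := by simpa using S.card_le_univ
  rw [hInst, mul_pow]
  set N : ℝ := (Fintype.card (Fin k → Fin n × Bool) : ℝ)
  calc N ^ S.card * ((1 - (1 / 2 : ℝ) ^ k) ^ (m - S.card) * N ^ (m - S.card))
      = (1 - (1 / 2 : ℝ) ^ k) ^ (m - S.card) * N ^ (S.card + (m - S.card)) := by rw [pow_add]; ring
    _ = (1 - (1 / 2 : ℝ) ^ k) ^ (m - S.card) * N ^ m := by rw [Nat.add_sub_cancel' hSm]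

/-- **Single-instance validity count.** For a fixed assignment `y`, the instances with at most `J`
clauses violated by `y` number at most `Σ_{j ≤ J} C(m,j) · (1 - 2^{-k})^{m-J} · #Inst`: the set of
violated clause indices has some size `j ≤ J`, and outside it every clause avoids the `n^k`
falsified ones. -/
private theorem ov_card_violCount_le (y : Fin n → Bool) (J : ℕ) :
    ((univ.filter fun Φ : Inst m k n => violCount y Φ ≤ J).card : ℝ) ≤
      (∑ j ∈ range (J + 1), (m.choose j : ℝ)) * (1 - (1 / 2 : ℝ) ^ k) ^ (m - J) *
        Fintype.card (Inst m k n) := by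
  obtain ⟨G, hG⟩ : ∃ G : Finset (Fin m) → Finset (Inst m k n), ∀ S, G S =
      Fintype.piFinset fun i : Fin m => if i ∈ S then (univ : Finset (Fin k → Fin n × Bool))
        else univ.filter fun C : Fin k → Fin n × Bool => ¬∀ r, y (C r).1 ≠ (C r).2 :=
    ⟨_, fun _ => rfl⟩
  have hq0 : 0 ≤ 1 - (1 / 2 : ℝ) ^ k := sub_nonneg.2 (pow_le_one₀ (by norm_num) (by norm_num))
  have hq1 : 1 - (1 / 2 : ℝ) ^ k ≤ 1 := sub_le_self _ (by positivity)
  -- the cover by product sets, indexed by the set of violated clauses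
  have hsub : (univ.filter fun Φ : Inst m k n => violCount y Φ ≤ J) ⊆
      (range (J + 1)).biUnion fun j => (powersetCard j univ).biUnion G := by
    intro Φ hΦ
    simp only [mem_filter, mem_univ, true_and] at hΦ
    simp only [mem_biUnion, mem_range, mem_powersetCard]
    refine ⟨violCount y Φ, Nat.lt_succ_of_le hΦ,
      univ.filter fun i : Fin m => ∀ r, y (Φ i r).1 ≠ (Φ i r).2, ⟨subset_univ _, rfl⟩, ?_⟩
    rw [hG, Fintype.mem_piFinset]
    intro i
    split_ifs with hi
    · exact mem_univ _
    · simp only [mem_filter, mem_univ, true_and] at hi ⊢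
      exact hi
  have hGcard : ∀ j ∈ range (J + 1), ∀ S ∈ powersetCard j (univ : Finset (Fin m)),
      ((G S).card : ℝ) ≤ (1 - (1 / 2 : ℝ) ^ k) ^ (m - J) * Fintype.card (Inst m k n) := by
    intro j hj S hS
    rw [mem_powersetCard] at hS
    rw [hG, ov_card_goodOutside]
    refine mul_le_mul_of_nonneg_right (pow_le_pow_of_le_one hq0 hq1 ?_) (Nat.cast_nonneg _)
    have := mem_range.1 hj
    omega
  calc ((univ.filter fun Φ : Inst m k n => violCount y Φ ≤ J).card : ℝ)
      ≤ ∑ j ∈ range (J + 1), ∑ S ∈ powersetCard j (univ : Finset (Fin m)), ((G S).card : ℝ) := by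
        exact_mod_cast (card_le_card hsub).trans
          (card_biUnion_le.trans (sum_le_sum fun j _ => card_biUnion_le))
    _ ≤ ∑ j ∈ range (J + 1), ∑ S ∈ powersetCard j (univ : Finset (Fin m)),
          (1 - (1 / 2 : ℝ) ^ k) ^ (m - J) * Fintype.card (Inst m k n) :=
        sum_le_sum fun j hj => sum_le_sum fun S hS => hGcard j hj S hS
    _ = (∑ j ∈ range (J + 1), (m.choose j : ℝ)) * (1 - (1 / 2 : ℝ) ^ k) ^ (m - J) *
          Fintype.card (Inst m k n) := by
        rw [sum_mul, sum_mul]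
        refine sum_congr rfl fun j _ => ?_
        rw [sum_const, card_powersetCard, card_univ, Fintype.card_fin, nsmul_eq_mul]
        ring


/-- The crude entropy bound for a binomial coefficient in `binEntropy` form:
`C(N, j) ≤ exp(N · h₂(j/N))` for `0 ≤ j ≤ N` (at `N = 0` both sides are `1`). -/
private theorem ov_choose_le_exp_binEntropy {N j : ℕ} (hjN : j ≤ N) :
    (N.choose j : ℝ) ≤ Real.exp (N * binEntropy ((j : ℝ) / N)) := by
  rcases Nat.eq_zero_or_pos N with rfl | hN
  · obtain rfl : j = 0 := Nat.le_zero.1 hjN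
    simp
  have hN' : (0 : ℝ) < N := by exact_mod_cast hN
  have h := Literature.Probability.LatticeModels.choose_le_exp_spinRate hjN
  rw [Literature.Probability.LatticeModels.spinRate_eq_log_two_sub_binEntropy] at h
  have e : (1 + (2 * (j : ℝ) - N) / N) / 2 = (j : ℝ) / N := by
    field_simp
    ring
  rw [e] at h
  have h2 : Real.exp ((N : ℝ) * Real.log 2) = 2 ^ N := by
    rw [Real.exp_nat_mul, Real.exp_log two_pos]
  calc (N.choose j : ℝ) ≤ 2 ^ N * Real.exp (-(N * (Real.log 2 - binEntropy ((j : ℝ) / N)))) := h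
    _ = Real.exp (N * binEntropy ((j : ℝ) / N)) := by
      rw [show -((N : ℝ) * (Real.log 2 - binEntropy ((j : ℝ) / N))) =
          N * binEntropy ((j : ℝ) / N) - N * Real.log 2 by ring, Real.exp_sub, h2]
      field_simp

end Copies

/-! ## The first-moment count -/

section FirstMoment

variable {k m n : ℕ}

/-- Product decomposition: a predicate on the origin `Ψ 0` cuts out `#{Φ : p Φ} · #Inst^k` paths. -/
theorem card_filter_origin (p : (Fin m → Fin k → Fin n × Bool) → Prop) [DecidablePred p] :
    (Finset.univ.filter fun Ψ : Fin (k + 1) → Fin m → Fin k → Fin n × Bool => p (Ψ 0)).card =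
      (Finset.univ.filter p).card * (Fintype.card (Fin m → Fin k → Fin n × Bool)) ^ k := by
  have key : (Finset.univ.filter fun Ψ : Fin (k + 1) → Fin m → Fin k → Fin n × Bool => p (Ψ 0)) =
      Fintype.piFinset fun i : Fin (k + 1) =>
        if i = 0 then Finset.univ.filter p else (Finset.univ : Finset (Fin m → Fin k → Fin n × Bool)) := by
    ext Ψ
    simp only [Finset.mem_filter, Finset.mem_univ, true_and, Fintype.mem_piFinset]
    constructor
    · intro h i
      split_ifs with hi
      · subst hi
        simpa using h
      · exact Finset.mem_univ _
    · intro h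
      simpa using h 0
  rw [key, Fintype.card_piFinset, Fin.prod_univ_succ]
  simp [Fin.succ_ne_zero, Finset.prod_const, Finset.card_univ]

/-- Union bound over an index type. -/
theorem card_filter_exists_le {α ι : Type*} [Fintype α] [Fintype ι] (P : ι → α → Prop)
    [∀ i, DecidablePred (P i)] [DecidablePred fun a => ∃ i, P i a] :
    (Finset.univ.filter fun a => ∃ i, P i a).card ≤ ∑ i, (Finset.univ.filter (P i)).card := by
  classical
  calc (Finset.univ.filter fun a => ∃ i, P i a).card
      ≤ ((Finset.univ : Finset ι).biUnion fun i => Finset.univ.filter (P i)).card := by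
        refine Finset.card_le_card fun a ha => ?_
        simp only [Finset.mem_filter, Finset.mem_univ, true_and] at ha
        obtain ⟨i, hi⟩ := ha
        exact Finset.mem_biUnion.2 ⟨i, Finset.mem_univ _, by simpa using hi⟩
    _ ≤ ∑ i, (Finset.univ.filter (P i)).card := Finset.card_biUnion_le

/-- Entropy bound for the partial binomial sum: `Σ_{j ≤ J} C(m, j) ≤ (J+1) e^{m h₂(ν)}` when
`J ≤ ν m`, `0 ≤ ν ≤ 1/2`. -/
theorem sum_choose_le_exp_binEntropy {J : ℕ} {ν : ℝ} (hν0 : 0 ≤ ν) (hν2 : ν ≤ 2⁻¹)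
    (hJ : (J : ℝ) ≤ ν * m) :
    ∑ j ∈ Finset.range (J + 1), (m.choose j : ℝ) ≤ (J + 1) * Real.exp (m * Real.binEntropy ν) := by
  have hνI : ν ∈ Set.Icc (0 : ℝ) 2⁻¹ := ⟨hν0, hν2⟩
  have hterm : ∀ j ∈ Finset.range (J + 1), (m.choose j : ℝ) ≤ Real.exp (m * Real.binEntropy ν) := by
    intro j hj
    have hjJ : j ≤ J := Nat.lt_succ_iff.1 (Finset.mem_range.1 hj)
    have hjR : (j : ℝ) ≤ ν * m := le_trans (by exact_mod_cast hjJ) hJ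
    have hjm : j ≤ m := by
      have : (j : ℝ) ≤ m := hjR.trans (by nlinarith [Nat.cast_nonneg (α := ℝ) m])
      exact_mod_cast this
    refine (ov_choose_le_exp_binEntropy hjm).trans (Real.exp_le_exp.2 ?_)
    rcases Nat.eq_zero_or_pos m with hm0 | hmpos
    · subst hm0; simp
    have hm' : (0 : ℝ) < m := by exact_mod_cast hmpos
    refine mul_le_mul_of_nonneg_left ?_ (Nat.cast_nonneg _)
    have hq0 : 0 ≤ (j : ℝ) / m := by positivity
    have hqν : (j : ℝ) / m ≤ ν := by
      rw [div_le_iff₀ hm']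
      exact hjR
    exact Real.binEntropy_strictMonoOn.monotoneOn ⟨hq0, hqν.trans hν2⟩ hνI hqν
  calc ∑ j ∈ Finset.range (J + 1), (m.choose j : ℝ)
      ≤ ∑ _j ∈ Finset.range (J + 1), Real.exp (m * Real.binEntropy ν) := Finset.sum_le_sum hterm
    _ = (J + 1) * Real.exp (m * Real.binEntropy ν) := by
        rw [Finset.sum_const, Finset.card_range, nsmul_eq_mul]
        push_cast
        ring

/-- Geometric factor: `(1 - 2^{-k})^{m - J} ≤ e^{-2^{-k} (m - J)}`. -/
theorem one_sub_pow_le_exp {J : ℕ} (hJm : J ≤ m) :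
    (1 - (1 / 2 : ℝ) ^ k) ^ (m - J) ≤ Real.exp (-((1 / 2 : ℝ) ^ k * ((m : ℝ) - J))) := by
  have hp1 : (1 / 2 : ℝ) ^ k ≤ 1 := pow_le_one₀ (by norm_num) (by norm_num)
  have h0 : 0 ≤ 1 - (1 / 2 : ℝ) ^ k := sub_nonneg.2 hp1
  calc (1 - (1 / 2 : ℝ) ^ k) ^ (m - J)
      ≤ (Real.exp (-((1 / 2 : ℝ) ^ k))) ^ (m - J) :=
        pow_le_pow_left₀ h0 (Real.one_sub_le_exp_neg _) _
    _ = Real.exp (-((1 / 2 : ℝ) ^ k * ((m : ℝ) - J))) := by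
        rw [← Real.exp_nat_mul, Nat.cast_sub hJm]
        ring_nf

/-- **First-moment count.** For any map `g` and `0 ≤ ν ≤ 1/2`, the paths on whose origin `Ψ 0` the
assignment `g (Ψ 0)` violates at most `ν m` clauses number at most
`2^n · (⌊ν m⌋₊ + 1) · e^{m h₂(ν)} · e^{-2^{-k}(1-ν) m} · #paths`. -/
theorem card_originValid_le {ν : ℝ} (hν0 : 0 ≤ ν) (hν2 : ν ≤ 2⁻¹)
    (g : (Fin m → Fin k → Fin n × Bool) → (Fin n → Bool)) :
    ((Finset.univ.filter fun Ψ : Fin (k + 1) → Fin m → Fin k → Fin n × Bool =>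
        (violCount (g (Ψ 0)) (Ψ 0) : ℝ) ≤ ν * m).card : ℝ) ≤
      (2 : ℝ) ^ n * ((⌊ν * m⌋₊ + 1) * Real.exp (m * Real.binEntropy ν)) *
        Real.exp (-((1 / 2 : ℝ) ^ k * ((1 - ν) * m))) *
        Fintype.card (Fin (k + 1) → Fin m → Fin k → Fin n × Bool) := by
  classical
  set J : ℕ := ⌊ν * m⌋₊ with hJdef
  have hJ : (J : ℝ) ≤ ν * m := Nat.floor_le (by positivity)
  have hJm : J ≤ m := by
    have : (J : ℝ) ≤ m := hJ.trans (by nlinarith [Nat.cast_nonneg (α := ℝ) m])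
    exact_mod_cast this
  -- (a) `ν`-validity of `g (Ψ 0)` at the origin gives some `J`-valid `y`
  have hsub : (Finset.univ.filter fun Ψ : Fin (k + 1) → Fin m → Fin k → Fin n × Bool =>
        (violCount (g (Ψ 0)) (Ψ 0) : ℝ) ≤ ν * m) ⊆
      Finset.univ.filter fun Ψ : Fin (k + 1) → Fin m → Fin k → Fin n × Bool =>
        ∃ y : Fin n → Bool, violCount y (Ψ 0) ≤ J := by
    intro Ψ hΨ
    simp only [Finset.mem_filter, Finset.mem_univ, true_and] at hΨ ⊢
    exact ⟨g (Ψ 0), Nat.le_floor hΨ⟩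
  -- (b) product decomposition and (c) union bound over `y` with the single-instance count
  have hInst : ((Finset.univ.filter fun Φ : Fin m → Fin k → Fin n × Bool =>
      ∃ y : Fin n → Bool, violCount y Φ ≤ J).card : ℝ) ≤
      (2 : ℝ) ^ n * ((∑ j ∈ Finset.range (J + 1), (m.choose j : ℝ)) * (1 - (1 / 2 : ℝ) ^ k) ^ (m - J) *
        Fintype.card (Fin m → Fin k → Fin n × Bool)) := by
    calc ((Finset.univ.filter fun Φ : Fin m → Fin k → Fin n × Bool =>
          ∃ y : Fin n → Bool, violCount y Φ ≤ J).card : ℝ)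
        ≤ ∑ y : Fin n → Bool, ((Finset.univ.filter fun Φ : Fin m → Fin k → Fin n × Bool =>
            violCount y Φ ≤ J).card : ℝ) := by
          exact_mod_cast card_filter_exists_le (fun (y : Fin n → Bool) (Φ : Fin m → Fin k → Fin n × Bool) =>
            violCount y Φ ≤ J)
      _ ≤ ∑ _y : Fin n → Bool, (∑ j ∈ Finset.range (J + 1), (m.choose j : ℝ)) *
            (1 - (1 / 2 : ℝ) ^ k) ^ (m - J) * Fintype.card (Fin m → Fin k → Fin n × Bool) :=
          Finset.sum_le_sum fun y _ => ov_card_violCount_le y J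
      _ = (2 : ℝ) ^ n * ((∑ j ∈ Finset.range (J + 1), (m.choose j : ℝ)) * (1 - (1 / 2 : ℝ) ^ k) ^ (m - J) *
            Fintype.card (Fin m → Fin k → Fin n × Bool)) := by
          rw [Finset.sum_const, Finset.card_univ, Fintype.card_fun, Fintype.card_bool, Fintype.card_fin,
            nsmul_eq_mul]
          push_cast
          ring
  -- (d) the two analytic factors
  have hS := sum_choose_le_exp_binEntropy (m := m) hν0 hν2 hJ
  have hG : (1 - (1 / 2 : ℝ) ^ k) ^ (m - J) ≤ Real.exp (-((1 / 2 : ℝ) ^ k * ((1 - ν) * m))) := by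
    refine (one_sub_pow_le_exp hJm).trans (Real.exp_le_exp.2 ?_)
    have hp0 : 0 ≤ (1 / 2 : ℝ) ^ k := by positivity
    nlinarith
  -- assemble
  have hcardI : (0 : ℝ) ≤ Fintype.card (Fin m → Fin k → Fin n × Bool) := Nat.cast_nonneg _
  have hsum0 : 0 ≤ ∑ j ∈ Finset.range (J + 1), (m.choose j : ℝ) :=
    Finset.sum_nonneg fun _ _ => Nat.cast_nonneg _
  have hgeom0 : 0 ≤ (1 - (1 / 2 : ℝ) ^ k) ^ (m - J) :=
    pow_nonneg (sub_nonneg.2 (pow_le_one₀ (by norm_num) (by norm_num))) _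
  have hpaths : (Fintype.card (Fin (k + 1) → Fin m → Fin k → Fin n × Bool) : ℝ) =
      Fintype.card (Fin m → Fin k → Fin n × Bool) *
        (Fintype.card (Fin m → Fin k → Fin n × Bool) : ℝ) ^ k := by
    rw [Fintype.card_fun (α := Fin (k + 1)), Fintype.card_fin, pow_succ']
    push_cast
    ring
  calc ((Finset.univ.filter fun Ψ : Fin (k + 1) → Fin m → Fin k → Fin n × Bool =>
        (violCount (g (Ψ 0)) (Ψ 0) : ℝ) ≤ ν * m).card : ℝ)
      ≤ ((Finset.univ.filter fun Ψ : Fin (k + 1) → Fin m → Fin k → Fin n × Bool =>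
          ∃ y : Fin n → Bool, violCount y (Ψ 0) ≤ J).card : ℝ) := by
        exact_mod_cast Finset.card_le_card hsub
    _ = ((Finset.univ.filter fun Φ : Fin m → Fin k → Fin n × Bool =>
          ∃ y : Fin n → Bool, violCount y Φ ≤ J).card : ℝ) *
          (Fintype.card (Fin m → Fin k → Fin n × Bool) : ℝ) ^ k := by
        rw [card_filter_origin (fun Φ : Fin m → Fin k → Fin n × Bool => ∃ y : Fin n → Bool, violCount y Φ ≤ J)]
        push_cast
        ring
    _ ≤ (2 : ℝ) ^ n * ((∑ j ∈ Finset.range (J + 1), (m.choose j : ℝ)) * (1 - (1 / 2 : ℝ) ^ k) ^ (m - J) *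
          Fintype.card (Fin m → Fin k → Fin n × Bool)) *
          (Fintype.card (Fin m → Fin k → Fin n × Bool) : ℝ) ^ k :=
        mul_le_mul_of_nonneg_right hInst (by positivity)
    _ ≤ (2 : ℝ) ^ n * (((J + 1) * Real.exp (m * Real.binEntropy ν)) *
          Real.exp (-((1 / 2 : ℝ) ^ k * ((1 - ν) * m))) *
          Fintype.card (Fin m → Fin k → Fin n × Bool)) *
          (Fintype.card (Fin m → Fin k → Fin n × Bool) : ℝ) ^ k := by
        gcongr
    _ = _ := by rw [hpaths]; ring

end FirstMoment

end Summit.PneNP.PneNP.Cruxes.SolvableImpliesStableSection.Negative
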